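import Mathlib.Analysis.Complex.Basic
import Mathlib.Algebra.BigOperators.Intervals
import Mathlib.Algebra.Order.BigOperators.Ring.Finset

/-!
# `BalabanUV.Beta.GAN24.DirichletRingEnergies` — binder row G-an2-4 / (CONV-C), road P2 PART IV, leaves L3–L4 of the ring lemma in model
# coordinates: SQUARE, RING AND OUTWARD BOND ENERGIES AROUND A RE-ENTRANT VERTEX, THE RING IDENTITY, THE GREEN IDENTITY ON THE SQUARE
# AND THE CAUCHY–SCHWARZ BOUND OF THE OUTWARD FLUX (unit b2b-balaban-gan24-p2, gen 25, v1)

HONEST FRAMING (cell contract, verbatim): «discharging `BetaPertH` makes Bałaban's UV stability UNCONDITIONAL — a real constructive-QFT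
result; it is NOT the continuum limit and NOT the Clay problem.»  Lattice-calculus brick for the ring lemma of memo
`HOME/b2b-balaban-gan24-p2/gen24/W-FULL-WEIGHTED.md` §3 (leaves L3, L4 in MODEL COORDINATES, and the Cauchy–Schwarz half of L5).  A field
`U : ℤ → ℤ → ℂ` on the plane lattice; the re-entrant vertex sits between the sites `(−1,−1)` and `(0,0)`; the squares around it are
`Q_k = [−k,k)²`, whose sites are written `(−k+s, −k+t)` with `s, t < 2k`.  Everything is a finite `range` sum:
 * §1 `hb`/`vb` (one bond), `EH`/`EV`/`En` (bonds inside `Q_k`), `Tan` (the `8k−4` tangential bonds of the ring `Q_k ∖ Q_{k−1}`),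
   `Rad` (the `8k` outward bonds of `Q_k`), `Et k = En k + Rad k` (the energy `Ẽ_k` of the ring recursion), `sqSum` (site sums over `Q_k`);
 * §2 `peel`/`peel₂` — peeling the first and last index of a shifted `range` sum (pure bookkeeping), **`En_succ`** — THE RING IDENTITY
   `E_{k+1} = E_k + Tan_{k+1} + Rad_k`, hence `Et_{k+1} − Et_k = Tan_{k+1} + Rad_{k+1}`; `sqSum_succ`/`sqSum_mono`;
 * §3 `abel_row` — 1-D summation by parts of `Σ φ̄·(2φ − φ(·+1) − φ(·−1))` on a segment, **`green_square`** — THE GREEN IDENTITY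
   `Σ_{x∈Q_k} Ū(x)(ΔU)(x) = E_k + flux_k` (a complex identity; `Δ` = the 5-point lattice Laplacian `lap`, `flux_k` = the outward flux);
 * §4 **`norm_flux_le`** — `‖flux_k‖ ≤ √Vb_k·√Rad_k`, `Vb_k` = the squared values on the ring counted with outward multiplicity.
The consumer (`DirichletRingDecay`, L5/L8) bounds `Vb_k` by the path Wirtinger inequality (`DirichletRingWirtinger`) and runs the recursion.

ABSOLUTE RULE (cell, verbatim): «No internally-minted statement may enter as a cited fact. Every hypothesis is either kernel-proved in
this package or a verbatim quotation of a PUBLISHED theorem with page reference. The manuscript(s) under audit are NOT citable for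
their own disputed steps — they are the thing under adjudication; programme-internal (2001/route/tribunal) claims are never citable.»
[folklore] finite lattice calculus; nothing printed is a hypothesis.  NOT CLAIMED: the ring lemma itself (L8), (A)/(B), NE2, (CONV-C),
`BetaPertH`, continuum, Clay.  «not in print; our proof attempt».  HONEST DEPENDENCY: continuum YM on T⁴ ⇐ BetaPertH ∧ nine spine estimates
(0/9 proved); BetaPertH ⇐ (D1) ∧ (D4) ∧ CAP+tail; G-an2-4 gates asym, D1 and NE2/3/4.
-/

noncomputable section

open scoped BigOperators ComplexConjugate
open Finset

namespace Summit.QuantumFields.BalabanUV.Beta.GAN24.DirichletRingEnergies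

variable (U : ℤ → ℤ → ℂ)

/-! ## §1 The energies -/

/-- energy of the horizontal bond `(i,j) → (i+1,j)`: `‖U(i+1,j) − U(i,j)‖²`. [folklore] -/
def hb (i j : ℤ) : ℝ := ‖U (i + 1) j - U i j‖ ^ 2

/-- energy of the vertical bond `(i,j) → (i,j+1)`: `‖U(i,j+1) − U(i,j)‖²`. [folklore] -/
def vb (i j : ℤ) : ℝ := ‖U i (j + 1) - U i j‖ ^ 2

/-- horizontal bond energy of the square `Q_k = [−k,k)²` (rows `j = −k+t`, `t < 2k`; bonds `i = −k+s → i+1`, `s < 2k−1`). [folklore] -/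
def EH (k : ℕ) : ℝ := ∑ t ∈ range (2 * k), ∑ s ∈ range (2 * k - 1), hb U (-(k : ℤ) + s) (-(k : ℤ) + t)

/-- vertical bond energy of the square `Q_k` (columns `i = −k+s`, `s < 2k`; bonds `j = −k+t → j+1`, `t < 2k−1`). [folklore] -/
def EV (k : ℕ) : ℝ := ∑ s ∈ range (2 * k), ∑ t ∈ range (2 * k - 1), vb U (-(k : ℤ) + s) (-(k : ℤ) + t)

/-- the bond energy `E_k` of the square `Q_k` (all bonds with both ends in `Q_k`). [folklore] -/
def En (k : ℕ) : ℝ := EH U k + EV U k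

/-- the TANGENTIAL energy of the ring `Q_k ∖ Q_{k−1}`: the `8k−4` bonds with both ends in the ring (bottom row `j = −k`, top row
`j = k−1`, left column `i = −k`, right column `i = k−1`). [folklore] -/
def Tan (k : ℕ) : ℝ :=
  ∑ s ∈ range (2 * k - 1), (hb U (-(k : ℤ) + s) (-(k : ℤ)) + hb U (-(k : ℤ) + s) ((k : ℤ) - 1))
    + ∑ t ∈ range (2 * k - 1), (vb U (-(k : ℤ)) (-(k : ℤ) + t) + vb U ((k : ℤ) - 1) (-(k : ℤ) + t))

/-- the RADIAL (outward) energy of `Q_k`: the `8k` bonds joining the ring `Q_k ∖ Q_{k−1}` to the next ring (left `(−k−1,j)–(−k,j)`,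
right `(k−1,j)–(k,j)`, bottom `(i,−k−1)–(i,−k)`, top `(i,k−1)–(i,k)`; a corner site carries two of them). [folklore] -/
def Rad (k : ℕ) : ℝ :=
  ∑ t ∈ range (2 * k), (hb U (-(k : ℤ) - 1) (-(k : ℤ) + t) + hb U ((k : ℤ) - 1) (-(k : ℤ) + t))
    + ∑ s ∈ range (2 * k), (vb U (-(k : ℤ) + s) (-(k : ℤ) - 1) + vb U (-(k : ℤ) + s) ((k : ℤ) - 1))

/-- the energy `Ẽ_k := E_k + Rad_k` of the ring recursion (all bonds with at least one end in `Q_k`). [folklore] -/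
def Et (k : ℕ) : ℝ := En U k + Rad U k

/-- a site sum over the square `Q_k`: `Σ_{t<2k} Σ_{s<2k} f(−k+s, −k+t)`. [folklore] -/
def sqSum (f : ℤ → ℤ → ℝ) (k : ℕ) : ℝ := ∑ t ∈ range (2 * k), ∑ s ∈ range (2 * k), f (-(k : ℤ) + s) (-(k : ℤ) + t)

/-- `0 ≤ hb`. [folklore] -/
theorem hb_nonneg (i j : ℤ) : 0 ≤ hb U i j := sq_nonneg _

/-- `0 ≤ vb`. [folklore] -/
theorem vb_nonneg (i j : ℤ) : 0 ≤ vb U i j := sq_nonneg _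

/-- `0 ≤ EH`. [folklore] -/
theorem EH_nonneg (k : ℕ) : 0 ≤ EH U k :=
  sum_nonneg fun _ _ => sum_nonneg fun _ _ => hb_nonneg U _ _

/-- `0 ≤ EV`. [folklore] -/
theorem EV_nonneg (k : ℕ) : 0 ≤ EV U k :=
  sum_nonneg fun _ _ => sum_nonneg fun _ _ => vb_nonneg U _ _

/-- `0 ≤ E_k`. [folklore] -/
theorem En_nonneg (k : ℕ) : 0 ≤ En U k := add_nonneg (EH_nonneg U k) (EV_nonneg U k)

/-- `0 ≤ Tan_k`. [folklore] -/
theorem Tan_nonneg (k : ℕ) : 0 ≤ Tan U k :=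
  add_nonneg (sum_nonneg fun _ _ => add_nonneg (hb_nonneg U _ _) (hb_nonneg U _ _))
    (sum_nonneg fun _ _ => add_nonneg (vb_nonneg U _ _) (vb_nonneg U _ _))

/-- `0 ≤ Rad_k`. [folklore] -/
theorem Rad_nonneg (k : ℕ) : 0 ≤ Rad U k :=
  add_nonneg (sum_nonneg fun _ _ => add_nonneg (hb_nonneg U _ _) (hb_nonneg U _ _))
    (sum_nonneg fun _ _ => add_nonneg (vb_nonneg U _ _) (vb_nonneg U _ _))

/-- `0 ≤ Ẽ_k`. [folklore] -/
theorem Et_nonneg (k : ℕ) : 0 ≤ Et U k := add_nonneg (En_nonneg U k) (Rad_nonneg U k)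

/-- `E_0 = 0` (the empty square). [folklore] -/
theorem En_zero : En U 0 = 0 := by simp [En, EH, EV]

/-- `Rad_0 = 0`. [folklore] -/
theorem Rad_zero : Rad U 0 = 0 := by simp [Rad]

/-- `Ẽ_0 = 0`. [folklore] -/
theorem Et_zero : Et U 0 = 0 := by simp [Et, En_zero, Rad_zero]

/-! ## §2 Peeling a shifted range sum; the ring identity -/

/-- peeling the first and the last index: `Σ_{s<N+2} φ(a+s) = φ(a) + φ(a+1+N) + Σ_{s<N} φ(a+1+s)`. [folklore] -/
theorem peel {M : Type*} [AddCommMonoid M] (φ : ℤ → M) (a : ℤ) (N : ℕ) :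
    ∑ s ∈ range (N + 2), φ (a + s) = φ a + φ (a + 1 + N) + ∑ s ∈ range N, φ (a + 1 + s) := by
  rw [sum_range_succ, sum_range_succ']
  have e1 : ∀ s : ℕ, a + ((s + 1 : ℕ) : ℤ) = a + 1 + s := fun s => by push_cast; ring
  simp only [e1, Nat.cast_zero, add_zero]
  abel

/-- the two-dimensional peel of `Σ_{t<N+2} Σ_{s<L+2} f(a+s, a+t)`: bottom row, top row, the two side columns of the middle rows, and the
inner block `Σ_{t<N} Σ_{s<L} f(a+1+s, a+1+t)`. [folklore] -/
theorem peel₂ {M : Type*} [AddCommMonoid M] (f : ℤ → ℤ → M) (a : ℤ) (N L : ℕ) :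
    ∑ t ∈ range (N + 2), ∑ s ∈ range (L + 2), f (a + s) (a + t)
      = ∑ s ∈ range (L + 2), f (a + s) a + ∑ s ∈ range (L + 2), f (a + s) (a + 1 + N)
        + ∑ t ∈ range N, (f a (a + 1 + t) + f (a + 1 + L) (a + 1 + t))
        + ∑ t ∈ range N, ∑ s ∈ range L, f (a + 1 + s) (a + 1 + t) := by
  rw [peel (fun j => ∑ s ∈ range (L + 2), f (a + s) j) a N]
  have hrow : ∀ t ∈ range N, ∑ s ∈ range (L + 2), f (a + s) (a + 1 + t)
      = (f a (a + 1 + t) + f (a + 1 + L) (a + 1 + t)) + ∑ s ∈ range L, f (a + 1 + s) (a + 1 + t) :=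
    fun t _ => peel (fun i => f i (a + 1 + t)) a L
  rw [sum_congr rfl hrow, sum_add_distrib]
  abel

/-- the two-dimensional peel with the OUTER index in the first argument: `Σ_{s<N+2} Σ_{t<L+2} f(a+s, a+t)`. [folklore] -/
theorem peel₂' {M : Type*} [AddCommMonoid M] (f : ℤ → ℤ → M) (a : ℤ) (N L : ℕ) :
    ∑ s ∈ range (N + 2), ∑ t ∈ range (L + 2), f (a + s) (a + t)
      = ∑ t ∈ range (L + 2), f a (a + t) + ∑ t ∈ range (L + 2), f (a + 1 + N) (a + t)
        + ∑ s ∈ range N, (f (a + 1 + s) a + f (a + 1 + s) (a + 1 + L))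
        + ∑ s ∈ range N, ∑ t ∈ range L, f (a + 1 + s) (a + 1 + t) := by
  have h := peel₂ (fun i j => f j i) a N L
  simpa only using h

/-- **THE RING IDENTITY**: `E_{k+1} = E_k + Tan_{k+1} + Rad_k` — the bonds of `Q_{k+1}` are the bonds of `Q_k`, the tangential bonds of the
ring `Q_{k+1} ∖ Q_k` and the outward bonds of `Q_k`. [folklore] -/
theorem En_succ (k : ℕ) : En U (k + 1) = En U k + Tan U (k + 1) + Rad U k := by
  rcases k with _ | k
  · simp [En, EH, EV, Tan, Rad, sum_range_succ]
  -- sizes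
  have e1 : 2 * (k + 1 + 1) = 2 * k + 2 + 2 := by ring
  have e2 : 2 * (k + 1 + 1) - 1 = (2 * k + 1) + 2 := by omega
  have e3 : 2 * (k + 1) = 2 * k + 2 := by ring
  have e4 : 2 * (k + 1) - 1 = 2 * k + 1 := by omega
  have ea : (-((k + 1 + 1 : ℕ) : ℤ)) = (-((k + 1 : ℕ) : ℤ) - 1) := by push_cast; ring
  -- horizontal part
  have hH : EH U (k + 1 + 1) = EH U (k + 1)
      + ∑ s ∈ range (2 * (k + 1 + 1) - 1), (hb U (-((k + 1 + 1 : ℕ) : ℤ) + s) (-((k + 1 + 1 : ℕ) : ℤ))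
          + hb U (-((k + 1 + 1 : ℕ) : ℤ) + s) (((k + 1 + 1 : ℕ) : ℤ) - 1))
      + ∑ t ∈ range (2 * (k + 1)), (hb U (-((k + 1 : ℕ) : ℤ) - 1) (-((k + 1 : ℕ) : ℤ) + t)
          + hb U (((k + 1 : ℕ) : ℤ) - 1) (-((k + 1 : ℕ) : ℤ) + t)) := by
    rw [EH, EH, e2, e1, e4, e3, ea, peel₂ (hb U) (-((k + 1 : ℕ) : ℤ) - 1) (2 * k + 2) (2 * k + 1)]
    have i1 : (-((k + 1 : ℕ) : ℤ) - 1 + 1 + ((2 * k + 2 : ℕ) : ℤ)) = ((k + 1 : ℕ) : ℤ) + 1 - 1 := by push_cast; ring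
    have i2 : (-((k + 1 : ℕ) : ℤ) - 1 + 1 + ((2 * k + 1 : ℕ) : ℤ)) = ((k + 1 : ℕ) : ℤ) - 1 := by push_cast; ring
    have i3 : ∀ s : ℕ, (-((k + 1 : ℕ) : ℤ) - 1 + 1 + (s : ℤ)) = -((k + 1 : ℕ) : ℤ) + s := fun s => by ring
    simp only [i1, i2, i3, sum_add_distrib]
    push_cast
    ring_nf
  -- vertical part
  have hV : EV U (k + 1 + 1) = EV U (k + 1)
      + ∑ t ∈ range (2 * (k + 1 + 1) - 1), (vb U (-((k + 1 + 1 : ℕ) : ℤ)) (-((k + 1 + 1 : ℕ) : ℤ) + t)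
          + vb U (((k + 1 + 1 : ℕ) : ℤ) - 1) (-((k + 1 + 1 : ℕ) : ℤ) + t))
      + ∑ s ∈ range (2 * (k + 1)), (vb U (-((k + 1 : ℕ) : ℤ) + s) (-((k + 1 : ℕ) : ℤ) - 1)
          + vb U (-((k + 1 : ℕ) : ℤ) + s) (((k + 1 : ℕ) : ℤ) - 1)) := by
    rw [EV, EV, e2, e1, e4, e3, ea, peel₂' (vb U) (-((k + 1 : ℕ) : ℤ) - 1) (2 * k + 2) (2 * k + 1)]
    have i1 : (-((k + 1 : ℕ) : ℤ) - 1 + 1 + ((2 * k + 2 : ℕ) : ℤ)) = ((k + 1 : ℕ) : ℤ) + 1 - 1 := by push_cast; ring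
    have i2 : (-((k + 1 : ℕ) : ℤ) - 1 + 1 + ((2 * k + 1 : ℕ) : ℤ)) = ((k + 1 : ℕ) : ℤ) - 1 := by push_cast; ring
    have i3 : ∀ s : ℕ, (-((k + 1 : ℕ) : ℤ) - 1 + 1 + (s : ℤ)) = -((k + 1 : ℕ) : ℤ) + s := fun s => by ring
    simp only [i1, i2, i3, sum_add_distrib]
    push_cast
    ring_nf
  rw [En, En, hH, hV, Tan, Rad]
  ring

/-- the increment of `Ẽ`: `Ẽ_{k+1} − Ẽ_k = Tan_{k+1} + Rad_{k+1}`. [folklore] -/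
theorem Et_succ_sub (k : ℕ) : Et U (k + 1) - Et U k = Tan U (k + 1) + Rad U (k + 1) := by
  rw [Et, Et, En_succ]; ring

/-- peeling a site sum: `sqSum f (k+1) = sqSum f k + (the 8k+4 ring sites)`. [folklore] -/
theorem sqSum_succ (f : ℤ → ℤ → ℝ) (k : ℕ) : sqSum f (k + 1) = sqSum f k
    + (∑ s ∈ range (2 * k + 2), f (-((k + 1 : ℕ) : ℤ) + s) (-((k + 1 : ℕ) : ℤ))
      + ∑ s ∈ range (2 * k + 2), f (-((k + 1 : ℕ) : ℤ) + s) ((k : ℕ) : ℤ)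
      + ∑ t ∈ range (2 * k), (f (-((k + 1 : ℕ) : ℤ)) (-(k : ℤ) + t) + f ((k : ℕ) : ℤ) (-(k : ℤ) + t))) := by
  have e1 : 2 * (k + 1) = 2 * k + 2 := by ring
  have ea : (-((k + 1 : ℕ) : ℤ)) = (-(k : ℤ) - 1) := by push_cast; ring
  rw [sqSum, sqSum, e1, ea, peel₂ f (-(k : ℤ) - 1) (2 * k) (2 * k)]
  have i1 : (-(k : ℤ) - 1 + 1 + ((2 * k : ℕ) : ℤ)) = ((k : ℕ) : ℤ) := by push_cast; ring
  have i3 : ∀ s : ℕ, (-(k : ℤ) - 1 + 1 + (s : ℤ)) = -(k : ℤ) + s := fun s => by ring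
  simp only [i1, i3]
  ring

/-- monotonicity of site sums of a nonnegative function in the square: `k ≤ n ⟹ sqSum f k ≤ sqSum f n`. [folklore] -/
theorem sqSum_mono (f : ℤ → ℤ → ℝ) (hf : ∀ i j, 0 ≤ f i j) {k n : ℕ} (hkn : k ≤ n) : sqSum f k ≤ sqSum f n := by
  induction n, hkn using Nat.le_induction with
  | base => exact le_rfl
  | succ n _ ih =>
      refine ih.trans ?_
      rw [sqSum_succ]
      refine le_add_of_nonneg_right (add_nonneg (add_nonneg ?_ ?_) ?_)
      · exact sum_nonneg fun _ _ => hf _ _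
      · exact sum_nonneg fun _ _ => hf _ _
      · exact sum_nonneg fun _ _ => add_nonneg (hf _ _) (hf _ _)

/-- `0 ≤ sqSum f k` for `f ≥ 0`. [folklore] -/
theorem sqSum_nonneg (f : ℤ → ℤ → ℝ) (hf : ∀ i j, 0 ≤ f i j) (k : ℕ) : 0 ≤ sqSum f k :=
  sum_nonneg fun _ _ => sum_nonneg fun _ _ => hf _ _

/-! ## §3 The lattice Laplacian, summation by parts, the Green identity on the square -/

/-- the 5-point lattice Laplacian (positive sign convention): `(ΔU)(i,j) = 4U(i,j) − U(i±1,j) − U(i,j±1)`, written as the sum of its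
horizontal and vertical second differences. [folklore] -/
def lap (i j : ℤ) : ℂ := (2 * U i j - U (i + 1) j - U (i - 1) j) + (2 * U i j - U i (j + 1) - U i (j - 1))

/-- the OUTWARD FLUX of `Q_k`: `Σ_{x ∈ ring, x+ν ∉ Q_k} Ū(x)(U(x) − U(x+ν))` over the `8k` outward bonds. [folklore] -/
def flux (k : ℕ) : ℂ :=
  ∑ t ∈ range (2 * k), (conj (U (-(k : ℤ)) (-(k : ℤ) + t)) * (U (-(k : ℤ)) (-(k : ℤ) + t) - U (-(k : ℤ) - 1) (-(k : ℤ) + t))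
      + conj (U ((k : ℤ) - 1) (-(k : ℤ) + t)) * (U ((k : ℤ) - 1) (-(k : ℤ) + t) - U ((k : ℤ) - 1 + 1) (-(k : ℤ) + t)))
    + ∑ s ∈ range (2 * k), (conj (U (-(k : ℤ) + s) (-(k : ℤ))) * (U (-(k : ℤ) + s) (-(k : ℤ)) - U (-(k : ℤ) + s) (-(k : ℤ) - 1))
      + conj (U (-(k : ℤ) + s) ((k : ℤ) - 1)) * (U (-(k : ℤ) + s) ((k : ℤ) - 1) - U (-(k : ℤ) + s) ((k : ℤ) - 1 + 1)))

/-- **summation by parts on a segment**: for `φ : ℤ → ℂ`, `a : ℤ`, `N : ℕ`,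
`Σ_{s≤N} φ̄(a+s)(2φ(a+s) − φ(a+s+1) − φ(a+s−1)) = Σ_{s<N} |φ(a+s+1) − φ(a+s)|² + φ̄(a)(φ(a) − φ(a−1)) + φ̄(a+N)(φ(a+N) − φ(a+N+1))`
(the squares written as `conj δ · δ`). [folklore] -/
theorem abel_row (φ : ℤ → ℂ) (a : ℤ) (N : ℕ) :
    ∑ s ∈ range (N + 1), conj (φ (a + s)) * (2 * φ (a + s) - φ (a + s + 1) - φ (a + s - 1))
      = ∑ s ∈ range N, conj (φ (a + s + 1) - φ (a + s)) * (φ (a + s + 1) - φ (a + s))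
        + conj (φ a) * (φ a - φ (a - 1)) + conj (φ (a + N)) * (φ (a + N) - φ (a + N + 1)) := by
  induction N with
  | zero =>
      simp only [zero_add, sum_range_one, sum_range_zero, Nat.cast_zero, add_zero]
      ring
  | succ N ih =>
      rw [sum_range_succ, ih, sum_range_succ]
      simp only [Nat.cast_succ, ← add_assoc, add_sub_cancel_right, map_sub]
      ring

/-- the energy form of `abel_row`: the squares as real norms. [folklore] -/
theorem abel_row_norm (φ : ℤ → ℂ) (a : ℤ) (N : ℕ) :
    ∑ s ∈ range (N + 1), conj (φ (a + s)) * (2 * φ (a + s) - φ (a + s + 1) - φ (a + s - 1))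
      = ((∑ s ∈ range N, ‖φ (a + s + 1) - φ (a + s)‖ ^ 2 : ℝ) : ℂ)
        + conj (φ a) * (φ a - φ (a - 1)) + conj (φ (a + N)) * (φ (a + N) - φ (a + N + 1)) := by
  rw [abel_row]
  push_cast
  simp only [Complex.conj_mul']

/-- **THE GREEN IDENTITY ON THE SQUARE**: for `k ≥ 1`,
`Σ_{t<2k} Σ_{s<2k} Ū(−k+s,−k+t)·(ΔU)(−k+s,−k+t) = E_k + flux_k` (interior bonds give their energy, outward bonds the flux). [folklore] -/
theorem green_square {k : ℕ} (hk : 1 ≤ k) :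
    ∑ t ∈ range (2 * k), ∑ s ∈ range (2 * k), conj (U (-(k : ℤ) + s) (-(k : ℤ) + t)) * lap U (-(k : ℤ) + s) (-(k : ℤ) + t)
      = ((En U k : ℝ) : ℂ) + flux U k := by
  obtain ⟨N, hN⟩ : ∃ N : ℕ, 2 * k = N + 1 := ⟨2 * k - 1, by omega⟩
  have hN' : 2 * k - 1 = N := by omega
  have hNz : ((N : ℕ) : ℤ) = 2 * (k : ℤ) - 1 := by omega
  -- split the Laplacian
  have hsplit : ∀ t ∈ range (2 * k), ∑ s ∈ range (2 * k), conj (U (-(k : ℤ) + s) (-(k : ℤ) + t)) * lap U (-(k : ℤ) + s) (-(k : ℤ) + t)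
      = ∑ s ∈ range (2 * k), conj (U (-(k : ℤ) + s) (-(k : ℤ) + t))
            * (2 * U (-(k : ℤ) + s) (-(k : ℤ) + t) - U (-(k : ℤ) + s + 1) (-(k : ℤ) + t) - U (-(k : ℤ) + s - 1) (-(k : ℤ) + t))
        + ∑ s ∈ range (2 * k), conj (U (-(k : ℤ) + s) (-(k : ℤ) + t))
            * (2 * U (-(k : ℤ) + s) (-(k : ℤ) + t) - U (-(k : ℤ) + s) (-(k : ℤ) + t + 1) - U (-(k : ℤ) + s) (-(k : ℤ) + t - 1)) := by
    intro t _
    rw [← sum_add_distrib]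
    refine sum_congr rfl fun s _ => ?_
    rw [lap]; ring
  rw [sum_congr rfl hsplit, sum_add_distrib]
  -- horizontal rows: summation by parts in `s` for each `t`
  have hH : ∀ t ∈ range (2 * k), ∑ s ∈ range (2 * k), conj (U (-(k : ℤ) + s) (-(k : ℤ) + t))
        * (2 * U (-(k : ℤ) + s) (-(k : ℤ) + t) - U (-(k : ℤ) + s + 1) (-(k : ℤ) + t) - U (-(k : ℤ) + s - 1) (-(k : ℤ) + t))
      = ((∑ s ∈ range N, ‖U (-(k : ℤ) + s + 1) (-(k : ℤ) + t) - U (-(k : ℤ) + s) (-(k : ℤ) + t)‖ ^ 2 : ℝ) : ℂ)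
        + conj (U (-(k : ℤ)) (-(k : ℤ) + t)) * (U (-(k : ℤ)) (-(k : ℤ) + t) - U (-(k : ℤ) - 1) (-(k : ℤ) + t))
        + conj (U (-(k : ℤ) + N) (-(k : ℤ) + t)) * (U (-(k : ℤ) + N) (-(k : ℤ) + t) - U (-(k : ℤ) + N + 1) (-(k : ℤ) + t)) := by
    intro t _
    rw [hN]
    exact abel_row_norm (fun i => U i (-(k : ℤ) + t)) (-(k : ℤ)) N
  -- vertical columns: swap the sums, then summation by parts in `t` for each `s`
  have hV : ∀ s ∈ range (2 * k), ∑ t ∈ range (2 * k), conj (U (-(k : ℤ) + s) (-(k : ℤ) + t))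
        * (2 * U (-(k : ℤ) + s) (-(k : ℤ) + t) - U (-(k : ℤ) + s) (-(k : ℤ) + t + 1) - U (-(k : ℤ) + s) (-(k : ℤ) + t - 1))
      = ((∑ t ∈ range N, ‖U (-(k : ℤ) + s) (-(k : ℤ) + t + 1) - U (-(k : ℤ) + s) (-(k : ℤ) + t)‖ ^ 2 : ℝ) : ℂ)
        + conj (U (-(k : ℤ) + s) (-(k : ℤ))) * (U (-(k : ℤ) + s) (-(k : ℤ)) - U (-(k : ℤ) + s) (-(k : ℤ) - 1))
        + conj (U (-(k : ℤ) + s) (-(k : ℤ) + N)) * (U (-(k : ℤ) + s) (-(k : ℤ) + N) - U (-(k : ℤ) + s) (-(k : ℤ) + N + 1)) := by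
    intro s _
    rw [hN]
    exact abel_row_norm (fun j => U (-(k : ℤ) + s) j) (-(k : ℤ)) N
  rw [sum_congr rfl hH]
  rw [sum_comm, sum_congr rfl hV]
  simp only [sum_add_distrib]
  have i1 : (-(k : ℤ) + (N : ℤ)) = (k : ℤ) - 1 := by rw [hNz]; ring
  simp only [i1, En, EH, EV, flux, hN', hb, vb, sum_add_distrib]
  push_cast
  ring_nf

/-! ## §4 The Cauchy–Schwarz bound of the flux -/

/-- the squared ring values counted with OUTWARD MULTIPLICITY (corner sites twice): `Vb_k`. [folklore] -/
def Vb (k : ℕ) : ℝ :=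
  ∑ t ∈ range (2 * k), (‖U (-(k : ℤ)) (-(k : ℤ) + t)‖ ^ 2 + ‖U ((k : ℤ) - 1) (-(k : ℤ) + t)‖ ^ 2)
    + ∑ s ∈ range (2 * k), (‖U (-(k : ℤ) + s) (-(k : ℤ))‖ ^ 2 + ‖U (-(k : ℤ) + s) ((k : ℤ) - 1)‖ ^ 2)

/-- `0 ≤ Vb_k`. [folklore] -/
theorem Vb_nonneg (k : ℕ) : 0 ≤ Vb U k :=
  add_nonneg (sum_nonneg fun _ _ => add_nonneg (sq_nonneg _) (sq_nonneg _))
    (sum_nonneg fun _ _ => add_nonneg (sq_nonneg _) (sq_nonneg _))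

/-- pairing two Cauchy–Schwarz bounds: `√A√B + √C√D ≤ √(A+C)·√(B+D)` for `A, B, C, D ≥ 0`. [folklore] -/
theorem sqrt_mul_sqrt_add_le {A B C D : ℝ} (hA : 0 ≤ A) (hB : 0 ≤ B) (hC : 0 ≤ C) (hD : 0 ≤ D) :
    Real.sqrt A * Real.sqrt B + Real.sqrt C * Real.sqrt D ≤ Real.sqrt (A + C) * Real.sqrt (B + D) := by
  rw [← Real.sqrt_mul (add_nonneg hA hC)]
  refine (Real.le_sqrt (by positivity) (by positivity)).mpr ?_
  have eA := Real.sq_sqrt hA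
  have eB := Real.sq_sqrt hB
  have eC := Real.sq_sqrt hC
  have eD := Real.sq_sqrt hD
  nlinarith [sq_nonneg (Real.sqrt A * Real.sqrt D - Real.sqrt C * Real.sqrt B), Real.sqrt_nonneg A, Real.sqrt_nonneg B,
    Real.sqrt_nonneg C, Real.sqrt_nonneg D, mul_nonneg (mul_nonneg (Real.sqrt_nonneg A) (Real.sqrt_nonneg D))
      (mul_nonneg (Real.sqrt_nonneg C) (Real.sqrt_nonneg B))]

/-- one flux term: `‖x̄·(x − y)‖ = ‖x‖·‖x − y‖`. [folklore] -/
theorem norm_conj_mul_sub' (x y : ℂ) : ‖conj x * (x - y)‖ = ‖x‖ * ‖x - y‖ := by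
  rw [norm_mul, Complex.norm_conj]

/-- one flux term, reversed bond orientation: `‖x̄·(x − y)‖ = ‖x‖·‖y − x‖`. [folklore] -/
theorem norm_conj_mul_sub (x y : ℂ) : ‖conj x * (x - y)‖ = ‖x‖ * ‖y - x‖ := by
  rw [norm_mul, Complex.norm_conj, norm_sub_rev]

/-- **CAUCHY–SCHWARZ FOR THE FLUX**: `‖flux_k‖ ≤ √Vb_k · √Rad_k`. [folklore] -/
theorem norm_flux_le (k : ℕ) : ‖flux U k‖ ≤ Real.sqrt (Vb U k) * Real.sqrt (Rad U k) := by
  -- the four families (left, right | bottom, top), values `a` and bond lengths `b`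
  set a1 : ℕ → ℝ := fun t => ‖U (-(k : ℤ)) (-(k : ℤ) + t)‖ with ha1
  set b1 : ℕ → ℝ := fun t => ‖U (-(k : ℤ)) (-(k : ℤ) + t) - U (-(k : ℤ) - 1) (-(k : ℤ) + t)‖ with hb1
  set a2 : ℕ → ℝ := fun t => ‖U ((k : ℤ) - 1) (-(k : ℤ) + t)‖ with ha2
  set b2 : ℕ → ℝ := fun t => ‖U ((k : ℤ) - 1 + 1) (-(k : ℤ) + t) - U ((k : ℤ) - 1) (-(k : ℤ) + t)‖ with hb2
  set a3 : ℕ → ℝ := fun s => ‖U (-(k : ℤ) + s) (-(k : ℤ))‖ with ha3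
  set b3 : ℕ → ℝ := fun s => ‖U (-(k : ℤ) + s) (-(k : ℤ)) - U (-(k : ℤ) + s) (-(k : ℤ) - 1)‖ with hb3
  set a4 : ℕ → ℝ := fun s => ‖U (-(k : ℤ) + s) ((k : ℤ) - 1)‖ with ha4
  set b4 : ℕ → ℝ := fun s => ‖U (-(k : ℤ) + s) ((k : ℤ) - 1 + 1) - U (-(k : ℤ) + s) ((k : ℤ) - 1)‖ with hb4
  -- termwise triangle inequality
  have h1 : ‖flux U k‖ ≤ (∑ t ∈ range (2 * k), a1 t * b1 t + ∑ t ∈ range (2 * k), a2 t * b2 t)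
      + (∑ s ∈ range (2 * k), a3 s * b3 s + ∑ s ∈ range (2 * k), a4 s * b4 s) := by
    rw [flux]
    refine (norm_add_le _ _).trans (add_le_add ?_ ?_)
    · rw [← sum_add_distrib]
      refine (norm_sum_le _ _).trans (sum_le_sum fun t _ => (norm_add_le _ _).trans ?_)
      rw [norm_conj_mul_sub', norm_conj_mul_sub]
    · rw [← sum_add_distrib]
      refine (norm_sum_le _ _).trans (sum_le_sum fun s _ => (norm_add_le _ _).trans ?_)
      rw [norm_conj_mul_sub', norm_conj_mul_sub]
  -- Cauchy–Schwarz per family and pairing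
  have hsq : ∀ f : ℕ → ℝ, 0 ≤ ∑ t ∈ range (2 * k), f t ^ 2 := fun f => sum_nonneg fun _ _ => sq_nonneg _
  have hA1 := hsq a1; have hA2 := hsq a2; have hA3 := hsq a3; have hA4 := hsq a4
  have hB1 := hsq b1; have hB2 := hsq b2; have hB3 := hsq b3; have hB4 := hsq b4
  have h2 : (∑ t ∈ range (2 * k), a1 t * b1 t + ∑ t ∈ range (2 * k), a2 t * b2 t)
      + (∑ s ∈ range (2 * k), a3 s * b3 s + ∑ s ∈ range (2 * k), a4 s * b4 s)
      ≤ Real.sqrt ((∑ t ∈ range (2 * k), a1 t ^ 2 + ∑ t ∈ range (2 * k), a2 t ^ 2)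
            + (∑ s ∈ range (2 * k), a3 s ^ 2 + ∑ s ∈ range (2 * k), a4 s ^ 2))
        * Real.sqrt ((∑ t ∈ range (2 * k), b1 t ^ 2 + ∑ t ∈ range (2 * k), b2 t ^ 2)
            + (∑ s ∈ range (2 * k), b3 s ^ 2 + ∑ s ∈ range (2 * k), b4 s ^ 2)) := by
    -- real Cauchy–Schwarz on `range (2k)` (the tree has it as `Literature.Computability.QuantumComplexity.sum_mul_le_sqrt_mul_sqrt`;
    -- re-derived locally from Mathlib's `sum_mul_sq_le_sq_mul_sq` to keep the imports topical)
    have cs : ∀ f g : ℕ → ℝ, ∑ i ∈ range (2 * k), f i * g i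
        ≤ Real.sqrt (∑ i ∈ range (2 * k), f i ^ 2) * Real.sqrt (∑ i ∈ range (2 * k), g i ^ 2) := fun f g => by
      have h := sum_mul_sq_le_sq_mul_sq (range (2 * k)) f g
      calc ∑ i ∈ range (2 * k), f i * g i ≤ |∑ i ∈ range (2 * k), f i * g i| := le_abs_self _
        _ = Real.sqrt ((∑ i ∈ range (2 * k), f i * g i) ^ 2) := (Real.sqrt_sq_eq_abs _).symm
        _ ≤ Real.sqrt ((∑ i ∈ range (2 * k), f i ^ 2) * ∑ i ∈ range (2 * k), g i ^ 2) := Real.sqrt_le_sqrt h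
        _ = Real.sqrt (∑ i ∈ range (2 * k), f i ^ 2) * Real.sqrt (∑ i ∈ range (2 * k), g i ^ 2) := Real.sqrt_mul (hsq f) _
    have c1 := cs a1 b1
    have c2 := cs a2 b2
    have c3 := cs a3 b3
    have c4 := cs a4 b4
    have p12 := sqrt_mul_sqrt_add_le hA1 hB1 hA2 hB2
    have p34 := sqrt_mul_sqrt_add_le hA3 hB3 hA4 hB4
    have p := sqrt_mul_sqrt_add_le (add_nonneg hA1 hA2) (add_nonneg hB1 hB2) (add_nonneg hA3 hA4) (add_nonneg hB3 hB4)
    linarith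
  have hVb : Vb U k = (∑ t ∈ range (2 * k), a1 t ^ 2 + ∑ t ∈ range (2 * k), a2 t ^ 2)
      + (∑ s ∈ range (2 * k), a3 s ^ 2 + ∑ s ∈ range (2 * k), a4 s ^ 2) := by
    simp only [Vb, ha1, ha2, ha3, ha4, sum_add_distrib]
  have hRad : Rad U k = (∑ t ∈ range (2 * k), b1 t ^ 2 + ∑ t ∈ range (2 * k), b2 t ^ 2)
      + (∑ s ∈ range (2 * k), b3 s ^ 2 + ∑ s ∈ range (2 * k), b4 s ^ 2) := by
    simp only [Rad, hb, vb, hb1, hb2, hb3, hb4, sum_add_distrib, sub_add_cancel]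
  rw [hVb, hRad]
  exact h1.trans h2

end Summit.QuantumFields.BalabanUV.Beta.GAN24.DirichletRingEnergies

end
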